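import Summits.Schanuel.Schanuel.Theorems.RootDecomp1KSiegelFunctions07

/-!
# RootDecomp1KSiegelFunctions — lens 1, generation 71, NODE 31 «THE HEIGHT BINDER HALVED: `HeightComparison ⟸ SiegelFunctionsAll`, ARITHMETIC HALF PROVED» (×0-AS-RECORD + one contingent ×1 at FLOOR G (a) — PRICE 31 L3149, RULING L3160, NODE L3172, VERDICT L3175): the node-12 hypothesis binder `HeightComparison` (Weil–Siegel height comparison on a plane curve) is, definitionally, `∀ P, GeomIrreducible P → 1 ≤ xdeg P → 1 ≤ deg_Y P → HeightComparisonAt P`, and `heightComparisonAt_of_siegelFunctions` PROVES `HeightComparisonAt P` from the GEOMETRIC datum `SiegelFunctions P ∧ SiegelFunctions (swap P)` (two integral functions of controlled degree for every b ≥ 1); the ARITHMETIC half (rational-root integrality, archimedean root bound, `h(y^b) = b·h(y)`, finite exceptional fibres by Bezout, exchange of variables) is proved sorry-free; hence `heightComparison_of_siegelFunctionsAll : SiegelFunctionsAll → HeightComparison` and the node-12 heads re-pointed BY NAME; the geometric half `SiegelFunctionsAll` is a typed HYPOTHESIS (plan S1–S6 in the docstring of `SiegelFunctions`), NOT proved;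 (G)-instances by hand: `parabP` / its transpose / `hyperbP`, and the infinite family 𝒞₃ = {(x·Y − 1)² − f(x) : f cubic, f(0) ≠ 1} in BOTH charts (Lucas trace; the 3 × 3 POWER LEMMA), its geometric irreducibility, and the HYPOTHESIS-FREE `heightComparisonAt_sqLinP` / `thinFibreAt_two_sqLinP` — ×0-AS-RECORD toolkit per RULING L3160 (every 𝒞₃ member is also decided by the numerator lever); `PadicSubspace`, items 33364 / 33363 / 31077 / 31987 and the tally UNMOVED — continuation (RootDecomp1KSiegelFunctions08): §10  CHART 2 OF `𝒞₃` — PROVED: `SiegelFunctions (swap ((xY − 1)² − f(x)))` for every cubic `f` — 40 declarations `q₃` … `heightComparisonAt_sqLinP_of_geomIrreducible`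

(lens-1 g71 NODE 31 «THE HEIGHT BINDER HALVED» L3172: HOME kernel K = HOME/decomp-schanuel-lens-1/g71/lean/SiegelFunctions.lean sha256 4f39c136…, 1983 l, 207 decls (173 theorems + 34 defs by the critic's count, VERDICT L3175; NODE's «208» an e-lite), ONE namespace `Summit.Schanuel.Schanuel.Theorems.RootDecomp1KSiegelFunctions` (inner anonymous-free sections `PowerLemma` / `Chart2` / `GeomIrreducible` with their `variable`s kept whole inside one part each), imports EXACTLY the tree port …RootDecomp1KHeightGrading02 (node 12: `HeightComparison`, `HeightDecidedAt`, `GeomIrreducible`, `logHt` BY TREE NAME) + `Literature.NumberTheory.DiophantineGeometry.PlaneCurveBezoutWeak` + `Mathlib.RingTheory.Polynomial.RationalRoot`; no private / instance / set_option / notation / sorry / new axiom / native_decide / [cite; lens farm rc 0 · 0 errors · 0 sorries · dupNamespace warnings only; `#print axioms` = [propext, Classical.choice, Quot.sound] on the nine probed heads (g71/out/ax_*.json), Probe g71/out/ProbeK.lean 2659bdec… rc 0 (rfl pin `HeightComparison` = tree), CONTROLS A / A0 / B rc 1 as designed (ctrlA 4ae3a6d6… / ctrlA0 ff875685… / ctrlB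 f20add70…), memo g71/NODE-g71.md 07fb49f8…, SHA256SUMS 34 files; CLAIM 31 L3146; crit PRICE 31 L3149 (×0-as-record + one contingent ×1 at FLOOR G; CHECKLIST K-g71; RULES K-R59 / K-R60 pre-announced); lens ASK-FIRST FAMILY CLAIM L3158 (𝒞₃) and crit RULING L3160 (𝒞₃ REFUSED as a FLOOR-G (b) family: numerator lever, NUMEXP; toolkit ×0 under K-R60 (i)); census INSTRUMENT NOTES 54–56 L3161 / L3163 / L3167 (LIVENESS-v46 / v47 / v48: rows 75–77 = 𝒞₃ members, keys numexp / numexp_tight / k60) and crit ACKs L3165 / L3168; writer NOTES 4 / 5 L3162 / L3173; crit-1 (g13) VERDICT 31 L3175: «NODE 31 = ×0-AS-RECORD BOOKED; CHECKLIST K-g71 (J1)–(J7) MET; the contingent THEOREM ×1 REGISTERED under K-R59 (ii), UNPAID (FLOOR G unmet); RULES K-R59 and K-R60 (i)–(iv) FIXED; PORT GO» — kernel re-verified by the critic (farm rc 0 · 0 errors · 0 sorries; 207 decls = 173 theorems + 34 defs; axioms standard re-probed on 27 heads), record: piece C227 «HeightComparison ⟸ SiegelFunctionsAll», the K-line binder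 HeightComparison henceforth CONSUMED through heightComparison_of_siegelFunctionsAll (Dom re-pointing BY NAME, antecedent count unchanged), 𝒞₃ / InC3 decided hypothesis-free by thinFibreAt_of_inC3 / thinFibreAt_two_sqLinP = the K-R60 (i) kernel shape (TOOLKIT, ×0, never payable), tally UNCHANGED lens-1 ×22 + THEOREM ×24, EXHIBITS ρ1 / ρ2 VACANT, 33364 / 33363 / 31077 / 31987 OPEN rung 0. Port by census-1 gen 26 as `RootDecomp1KSiegelFunctions01–09` (files ≤ 400 lines; chain 01 ← the three K imports, 0k ← 0(k−1); `--supports stmt-Schanuel-33364`, the item stays OPEN; ×0 record port — the geometric binder `SiegelFunctions` / `SiegelFunctionsAll` appears ONLY as an explicit hypothesis of the `…_of_siegelFunctions…` heads, never an axiom / instance / variable; no credit anywhere; the section-aligned 9-part split is lens-1's port plan (J7) re-built by the census pipeline): 01 = K-port l.1–216 (§0 / §1) — 25 decls `ratModel`, `QDvd`, `relPoly`, …, `evalEval_ratModel_relPoly`; 02 = K-port l.219–450 (§2) — 20 decls `scaledEval`, `l1`, `l1_nonneg`, …, `abs_le_of_rel`; 03 = K-port l.453–658 (§3 / §4) — 9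 decls `HtQ_pow`, `logHt_pow`, `HtQ_intDiv_le`, …, `upperComparisonAt_of_siegelFunctions`; 04 = K-port l.661–830 (§5) — 13 decls `coeff_coeff_swap`, `map_swap`, `natDegree_swap`, …, `heightComparison_of_siegelFunctions`; 05 = K-port l.833–1109 (§6 / §7) — 28 decls `thinFibreAt_of_heightComparisonAt`, `thinFibreAt_of_heightComparison'`, `thinFibreAt_of_siegelFunctions`, …, `siegelFunctions_toys`; 06 = K-port l.1111–1304 (§8) — 20 decls `sqLinP`, `sqLinP_eq`, `natDegree_sqLinP`, …, `thinFibreAt_sqLinP_of_swap`; 07 = K-port l.1306–1551 (§9) — 35 decls `compM`, `cubic`, `cubic_eq`, …, `natDegree_det3_compM_pow_le`; 08 = K-port l.1553–1860 (§10) — 40 decls `q₃`, `q₂`, `q₁`, …, `heightComparisonAt_sqLinP_of_geomIrreducible`; 09 = K-port l.1862–2078 (§11 / §12) — 17 decls `sqLinK`, `coeff_sqLinK`, `natDegree_sqLinK`, …, `thinFibreAt_of_inC3`. 91 one-line docstrings synthesised for undocumented helper declarations (statements quoted); TWO port-side modifiers of record: `sum_Icc_half_pow` (§2, part 02) is `private`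 with a PORT NOTE after the `dedup.landed` bounce p850627 (≡ `Literature.Computability.Cryptography.HashDom.sum_Icc_half_pow`), and the consistency check `thinFibreAt_of_heightComparison'` (§6, part 05) is `private` with a PORT NOTE after the `dedup.landed` bounce p850703 (≡ node 12's `RootDecomp1KHeightGrading.thinFibreAt_of_heightComparison`, the intended identity); everything else = K VERBATIM (statements, names, proofs, K's module docstring kept in part 01 below this provenance block).)
-/

noncomputable section

namespace Summit.Schanuel.Schanuel.Theorems.RootDecomp1KSiegelFunctions

open Polynomial
open scoped Nat
open Summit.Schanuel.Schanuel.Theorems.RootDecomp1KDegreeLadder (bev xdeg natDegree_coeff_le_xdeg ThinFibreAt ThinFibre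
  thinFibreAt_of_natDegree_lt)
open Summit.Schanuel.Schanuel.Theorems.RootDecomp1KHeightGrading

/-! ### §10  CHART 2 OF `𝒞₃` — PROVED: `SiegelFunctions (swap ((xY − 1)² − f(x)))` for every cubic `f`
with `f(0) ≠ 1`.  In the transposed chart `Q = q₃Y³ + q₂Y² + q₁Y + q₀` (`q₃ = −f₃`, `q₂ = x² − f₂`,
`q₁ = −(2x + f₁)`, `q₀ = 1 − f₀`, so `deg_Y Q = 3`, `xdeg Q = 2`) the Siegel functions are, for `b ≥ 1`,
`φ = N^j`, `ψ = N^j·Y^b` with `N := −(q₃Y² + q₂Y + q₁)` (the pole-free avatar of `q₀/Y`: `N·Y = q₀ − Q`),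
`j = ⌈2b/3⌉… := (2b+2)/3`, `e = b − j`, `a = max j 2e`, budget `3a ≤ 2b + 2` (`c = 2`).  Integrality:
`N` is a root of the monic cubic `S³ + q₁S² + q₀q₂S + q₀²q₃` (weights `a₀ = 1`) and `q₃Y` of
`S³ + q₂S² + q₃q₁S + q₃²q₀` (weights `a₀ = 2`); the POWER LEMMA (§9) gives the relations of `N^j` and
`(q₃Y)^e`, and `ψ·q₃^e ≡ q₀^j·(q₃Y)^e (mod Q)` transports the latter to `ψ`.  No division anywhere. -/

section Chart2

/-- `q₃ = −f₃`. -/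
def q₃ (f : ℤ[X]) : ℤ[X] := C (-f.coeff 3)
/-- `q₂ = x² − f₂`. -/
def q₂ (f : ℤ[X]) : ℤ[X] := X ^ 2 - C (f.coeff 2)
/-- `q₁ = −(2x + f₁)`. -/
def q₁ (f : ℤ[X]) : ℤ[X] := -(C 2 * X + C (f.coeff 1))
/-- `q₀ = 1 − f₀`. -/
def q₀ (f : ℤ[X]) : ℤ[X] := C (1 - f.coeff 0)

/-- the transposed chart of `𝒞₃`, as a cubic in `Y` over `ℤ[x]`. -/
def sqLinQ (f : ℤ[X]) : ℤ[X][X] := C (q₃ f) * X ^ 3 + C (q₂ f) * X ^ 2 + C (q₁ f) * X + C (q₀ f)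

/-- `{f : ℤ[X]} (hf : f.natDegree ≤ 3) : f = C (f.coeff 0) + C (f.coeff 1) * X + C (f.coeff 2) * X ^ 2 + C (f.coeff 3) * X ^ 3`. -/
theorem eq_cubic_of_natDegree_le {f : ℤ[X]} (hf : f.natDegree ≤ 3) :
    f = C (f.coeff 0) + C (f.coeff 1) * X + C (f.coeff 2) * X ^ 2 + C (f.coeff 3) * X ^ 3 := by
  ext k
  simp only [coeff_add, coeff_C_mul, coeff_X_pow, coeff_C, coeff_X]
  rcases Nat.lt_or_ge k 4 with h | h
  · interval_cases k <;> simp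
  · rw [coeff_eq_zero_of_natDegree_lt (by omega)]
    simp [show k ≠ 0 by omega, show k ≠ 2 by omega, show k ≠ 3 by omega, show (1 : ℕ) ≠ k by omega]

/-- the transpose of `(xY − 1)² − f(x)` IS `sqLinQ f` (for `deg f ≤ 3`). -/
theorem swap_sqLinP_eq {f : ℤ[X]} (hf : f.natDegree ≤ 3) : Bivariate.swap (sqLinP f) = sqLinQ f := by
  rw [swap_sqLinP]
  conv_lhs => rw [eq_cubic_of_natDegree_le hf]
  simp only [sqLinQ, q₃, q₂, q₁, q₀, hyperbP, Polynomial.map_add, Polynomial.map_mul, Polynomial.map_pow,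
    Polynomial.map_C, Polynomial.map_X, map_sub, map_neg, map_mul, map_pow, map_add, map_one, map_ofNat]
  ring

/-- `{f : ℤ[X]} (h3 : f.coeff 3 ≠ 0) : q₃ f ≠ 0`. -/
theorem q₃_ne_zero {f : ℤ[X]} (h3 : f.coeff 3 ≠ 0) : q₃ f ≠ 0 := by
  rw [q₃, Ne, C_eq_zero, neg_eq_zero]; exact h3

/-- `{f : ℤ[X]} (h0 : f.coeff 0 ≠ 1) : q₀ f ≠ 0`. -/
theorem q₀_ne_zero {f : ℤ[X]} (h0 : f.coeff 0 ≠ 1) : q₀ f ≠ 0 := by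
  rw [q₀, Ne, C_eq_zero, sub_eq_zero]; exact fun h => h0 h.symm

/-- `{f : ℤ[X]} (h3 : f.coeff 3 ≠ 0) : (sqLinQ f).natDegree = 3`. -/
theorem natDegree_sqLinQ {f : ℤ[X]} (h3 : f.coeff 3 ≠ 0) : (sqLinQ f).natDegree = 3 := by
  unfold sqLinQ; exact natDegree_cubic (q₃_ne_zero h3)

/-- `(f : ℤ[X]) : (q₁ f).natDegree ≤ 1`. -/
theorem natDegree_q₁_le (f : ℤ[X]) : (q₁ f).natDegree ≤ 1 := by
  unfold q₁; rw [natDegree_neg]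
  exact natDegree_add_le_of_degree_le ((natDegree_C_mul_le _ _).trans (by simp)) (by simp)

/-- `(f : ℤ[X]) : (q₂ f).natDegree = 2`. -/
theorem natDegree_q₂ (f : ℤ[X]) : (q₂ f).natDegree = 2 := by unfold q₂; exact natDegree_X_pow_sub_C

/-- `(f : ℤ[X]) (n : ℕ) : (sqLinQ f).coeff n = if n = 3 then q₃ f else if n = 2 then q₂ f else if n = 1 then q₁ f else if n = 0 then q₀ f else 0`. -/
theorem coeff_sqLinQ (f : ℤ[X]) (n : ℕ) : (sqLinQ f).coeff n =
    if n = 3 then q₃ f else if n = 2 then q₂ f else if n = 1 then q₁ f else if n = 0 then q₀ f else 0 := by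
  simp only [sqLinQ, coeff_add, coeff_C_mul, coeff_X_pow, coeff_X, coeff_C]
  rcases Nat.lt_or_ge n 4 with h | h
  · interval_cases n <;> simp
  · simp [show n ≠ 0 by omega, show n ≠ 2 by omega, show n ≠ 3 by omega, show (1 : ℕ) ≠ n by omega,
      show n ≠ 1 by omega]

/-- `(f : ℤ[X]) : xdeg (sqLinQ f) = 2`. -/
theorem xdeg_sqLinQ (f : ℤ[X]) : xdeg (sqLinQ f) = 2 := by
  apply le_antisymm
  · refine xdeg_le_of_coeff fun n => ?_
    rw [coeff_sqLinQ]
    split_ifs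
    · rw [q₃, natDegree_C]; exact Nat.zero_le _
    · rw [natDegree_q₂]
    · exact (natDegree_q₁_le f).trans (by norm_num)
    · rw [q₀, natDegree_C]; exact Nat.zero_le _
    · simp
  · have e2 : (sqLinQ f).coeff 2 = q₂ f := by rw [coeff_sqLinQ]; simp
    have := natDegree_coeff_le_xdeg (sqLinQ f) 2
    rwa [e2, natDegree_q₂] at this

/-- the pole-free avatar of `q₀/Y`: `N := −(q₃Y² + q₂Y + q₁)`, `N·Y = q₀ − Q`. -/
def N (f : ℤ[X]) : ℤ[X][X] := -(C (q₃ f) * X ^ 2 + C (q₂ f) * X + C (q₁ f))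

/-- `(f : ℤ[X]) : N f * X = C (q₀ f) - sqLinQ f`. -/
theorem N_mul_X (f : ℤ[X]) : N f * X = C (q₀ f) - sqLinQ f := by
  simp only [N, sqLinQ]; ring

/-- `: Finset.Icc 1 3 = ({1, 2, 3} : Finset ℕ)`. -/
theorem Icc_one_three : Finset.Icc 1 3 = ({1, 2, 3} : Finset ℕ) := by
  ext i; simp only [Finset.mem_Icc, Finset.mem_insert, Finset.mem_singleton]; omega

/-- `(D : ℤ) (χ : ℕ → ℤ[X]) (G H : ℤ[X][X]) : relPoly 3 D χ G H = C (C D) * G ^ 3 + C (χ 1) * G ^ 2 * H + C (χ 2) * G * H ^ 2 + C (χ 3) * H ^ 3`. -/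
theorem relPoly_three (D : ℤ) (χ : ℕ → ℤ[X]) (G H : ℤ[X][X]) : relPoly 3 D χ G H =
    C (C D) * G ^ 3 + C (χ 1) * G ^ 2 * H + C (χ 2) * G * H ^ 2 + C (χ 3) * H ^ 3 := by
  rw [relPoly, Icc_one_three, Finset.sum_insert (by simp), Finset.sum_insert (by simp), Finset.sum_singleton]
  simp only [Nat.sub_self, pow_zero, pow_one, mul_one, show 3 - 1 = 2 from rfl, show 3 - 2 = 1 from rfl]
  ring

/-- `{P : ℤ[X][X]} {a a' : ℕ} {G H : ℤ[X][X]} (h : a ≤ a') (hI : IntegralOfDegree P a G H) : IntegralOfDegree P a' G H`. -/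
theorem integralOfDegree_mono {P : ℤ[X][X]} {a a' : ℕ} {G H : ℤ[X][X]} (h : a ≤ a')
    (hI : IntegralOfDegree P a G H) : IntegralOfDegree P a' G H := by
  obtain ⟨m, D, χ, hD, hχ, hdvd⟩ := hI
  exact ⟨m, D, χ, hD, fun i => (hχ i).trans (Nat.mul_le_mul_right i h), hdvd⟩

/-- `{p q : ℤ[X][X]} (h : p ∣ q) (r : ℤ[X][X]) : p.comp r ∣ q.comp r`. -/
theorem comp_dvd_comp {p q : ℤ[X][X]} (h : p ∣ q) (r : ℤ[X][X]) : p.comp r ∣ q.comp r := by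
  obtain ⟨κ, hκ⟩ := h; exact ⟨κ.comp r, by rw [hκ, mul_comp]⟩

/-- the monic cubic of `N`: `μ_N(N) = Q·(q₂N + q₃(q₀ + NY))`. -/
theorem cubicN_comp (f : ℤ[X]) : (cubic (-q₁ f) (q₀ f * q₂ f) (-(q₀ f ^ 2 * q₃ f))).comp (N f) =
    sqLinQ f * (C (q₂ f) * N f + C (q₃ f) * (C (q₀ f) + N f * X)) := by
  simp only [cubic_eq, sub_comp, add_comp, mul_comp, pow_comp, X_comp, C_comp, neg_comp, map_neg, map_mul,
    map_pow]
  simp only [N, sqLinQ]; ring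

/-- the monic cubic of `q₃Y`: `μ'(q₃Y) = q₃²·Q`. -/
theorem cubicY_comp (f : ℤ[X]) : (cubic (-q₂ f) (q₃ f * q₁ f) (-(q₃ f ^ 2 * q₀ f))).comp (C (q₃ f) * X) =
    C (q₃ f) ^ 2 * sqLinQ f := by
  simp only [cubic_eq, sub_comp, add_comp, mul_comp, pow_comp, X_comp, C_comp, neg_comp, map_neg, map_mul,
    map_pow]
  simp only [sqLinQ]; ring

/-- `(f : ℤ[X]) (j : ℕ) : sqLinQ f ∣ (powRel (-q₁ f) (q₀ f * q₂ f) (-(q₀ f ^ 2 * q₃ f)) j).comp (N f)`. -/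
theorem sqLinQ_dvd_powRelN (f : ℤ[X]) (j : ℕ) :
    sqLinQ f ∣ (powRel (-q₁ f) (q₀ f * q₂ f) (-(q₀ f ^ 2 * q₃ f)) j).comp (N f) := by
  have h := comp_dvd_comp (cubic_dvd_powRel (-q₁ f) (q₀ f * q₂ f) (-(q₀ f ^ 2 * q₃ f)) j) (N f)
  rw [cubicN_comp] at h
  exact dvd_trans (dvd_mul_right _ _) h

/-- `(f : ℤ[X]) (e : ℕ) : sqLinQ f ∣ (powRel (-q₂ f) (q₃ f * q₁ f) (-(q₃ f ^ 2 * q₀ f)) e).comp (C (q₃ f) * X)`. -/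
theorem sqLinQ_dvd_powRelY (f : ℤ[X]) (e : ℕ) :
    sqLinQ f ∣ (powRel (-q₂ f) (q₃ f * q₁ f) (-(q₃ f ^ 2 * q₀ f)) e).comp (C (q₃ f) * X) := by
  have h := comp_dvd_comp (cubic_dvd_powRel (-q₂ f) (q₃ f * q₁ f) (-(q₃ f ^ 2 * q₀ f)) e) (C (q₃ f) * X)
  rw [cubicY_comp] at h
  exact dvd_trans (dvd_mul_left _ _) h

/-- `(f : ℤ[X]) (j : ℕ) : sqLinQ f ∣ (N f * X) ^ j - C (q₀ f) ^ j`. -/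
theorem sqLinQ_dvd_NX_pow_sub (f : ℤ[X]) (j : ℕ) : sqLinQ f ∣ (N f * X) ^ j - C (q₀ f) ^ j := by
  refine dvd_trans ?_ (sub_dvd_pow_sub_pow (N f * X) (C (q₀ f)) j)
  rw [N_mul_X]; exact ⟨-1, by ring⟩

/-- `(f : ℤ[X]) (j k : ℕ) : (q₀ f ^ j * q₃ f ^ k).natDegree = 0`. -/
theorem natDegree_q₀_pow_mul_q₃_pow (f : ℤ[X]) (j k : ℕ) : (q₀ f ^ j * q₃ f ^ k).natDegree = 0 := by
  rw [q₀, q₃, ← map_pow, ← map_pow, ← map_mul, natDegree_C]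

/-- the coefficient vector `(χ₁, χ₂, χ₃)` of a cubic relation. -/
def chi3 (a b c : ℤ[X]) : ℕ → ℤ[X] := fun i => if i = 1 then a else if i = 2 then b else if i = 3 then c else 0

/-- `(a b c : ℤ[X]) : chi3 a b c 1 = a`. -/
@[simp] theorem chi3_one (a b c : ℤ[X]) : chi3 a b c 1 = a := by simp [chi3]
/-- `(a b c : ℤ[X]) : chi3 a b c 2 = b`. -/
@[simp] theorem chi3_two (a b c : ℤ[X]) : chi3 a b c 2 = b := by simp [chi3]
/-- `(a b c : ℤ[X]) : chi3 a b c 3 = c`. -/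
@[simp] theorem chi3_three (a b c : ℤ[X]) : chi3 a b c 3 = c := by simp [chi3]

/-- `{a b c : ℤ[X]} {w : ℕ} (ha : a.natDegree ≤ w) (hb : b.natDegree ≤ w * 2) (hc : c.natDegree ≤ w * 3) : ∀ i, (chi3 a b c i).natDegree ≤ w * i`. -/
theorem chi3_natDegree_le {a b c : ℤ[X]} {w : ℕ} (ha : a.natDegree ≤ w) (hb : b.natDegree ≤ w * 2)
    (hc : c.natDegree ≤ w * 3) : ∀ i, (chi3 a b c i).natDegree ≤ w * i := by
  intro i
  unfold chi3
  split_ifs with h1 h2 h3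
  · subst h1; rwa [mul_one]
  · subst h2; exact hb
  · subst h3; exact hc
  · simp

/-- `φ = N^j` is integral of degree `≤ j` on `Q = 0` (power lemma with `a₀ = 1`). -/
theorem integralOfDegree_N_pow (f : ℤ[X]) (j : ℕ) : IntegralOfDegree (sqLinQ f) j (N f ^ j) 1 := by
  set M := compM (-q₁ f) (q₀ f * q₂ f) (-(q₀ f ^ 2 * q₃ f)) with hM
  have h₁ : (-q₁ f).natDegree ≤ 1 := by rw [natDegree_neg]; exact natDegree_q₁_le f
  have h₂ : (q₀ f * q₂ f).natDegree ≤ 2 * 1 := by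
    refine natDegree_mul_le.trans ?_; rw [natDegree_q₂, q₀, natDegree_C]
  have h₃ : (-(q₀ f ^ 2 * q₃ f)).natDegree ≤ 3 * 1 := by
    rw [natDegree_neg, show q₀ f ^ 2 * q₃ f = q₀ f ^ 2 * q₃ f ^ 1 by rw [pow_one],
      natDegree_q₀_pow_mul_q₃_pow]
    norm_num
  refine ⟨3, 1, chi3 (-tr3 (M ^ j)) (c23 (M ^ j)) (-det3 (M ^ j)), one_ne_zero,
    chi3_natDegree_le ?_ ?_ ?_, ?_⟩
  · rw [natDegree_neg]; exact (natDegree_tr3_compM_pow_le h₁ h₂ h₃ j).trans (by omega)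
  · exact (natDegree_c23_compM_pow_le h₁ h₂ h₃ j).trans (by omega)
  · rw [natDegree_neg]; exact (natDegree_det3_compM_pow_le h₃ j).trans (by omega)
  · have hrel : relPoly 3 1 (chi3 (-tr3 (M ^ j)) (c23 (M ^ j)) (-det3 (M ^ j))) (N f ^ j) 1 =
        (powRel (-q₁ f) (q₀ f * q₂ f) (-(q₀ f ^ 2 * q₃ f)) j).comp (N f) := by
      rw [relPoly_three, powRel, ← hM, chi3_one, chi3_two, chi3_three]
      simp only [sub_comp, add_comp, mul_comp, pow_comp, X_comp, C_comp, map_one, map_neg, one_pow, mul_one,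
        one_mul]
      ring
    unfold QDvd
    rw [hrel, ratModel_apply, ratModel_apply]
    exact map_dvd (mapRingHom (Int.castRingHom ℚ)) (sqLinQ_dvd_powRelN f j)

/-- `ψ = N^j·Y^{j+e}` is integral of degree `≤ 2e` on `Q = 0` (power lemma with `a₀ = 2` for `q₃Y`, transported
along `q₃^e·ψ ≡ q₀^j·(q₃Y)^e`). -/
theorem integralOfDegree_N_pow_mul_X_pow {f : ℤ[X]} (h3 : f.coeff 3 ≠ 0) (j e : ℕ) :
    IntegralOfDegree (sqLinQ f) (2 * e) (N f ^ j * X ^ (j + e)) 1 := by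
  set M := compM (-q₂ f) (q₃ f * q₁ f) (-(q₃ f ^ 2 * q₀ f)) with hM
  have h₁ : (-q₂ f).natDegree ≤ 2 := by rw [natDegree_neg, natDegree_q₂]
  have h₂ : (q₃ f * q₁ f).natDegree ≤ 2 * 2 := by
    refine natDegree_mul_le.trans ?_; rw [q₃, natDegree_C, zero_add]
    exact (natDegree_q₁_le f).trans (by norm_num)
  have h₃ : (-(q₃ f ^ 2 * q₀ f)).natDegree ≤ 3 * 2 := by
    rw [natDegree_neg, show q₃ f ^ 2 * q₀ f = q₀ f ^ 1 * q₃ f ^ 2 by rw [pow_one, mul_comm],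
      natDegree_q₀_pow_mul_q₃_pow]
    norm_num
  set t := tr3 (M ^ e) with ht
  set σ := c23 (M ^ e) with hσ
  set d := det3 (M ^ e) with hd
  refine ⟨3, (-f.coeff 3) ^ (3 * e), chi3 (-(t * (q₀ f ^ j * q₃ f ^ (2 * e))))
    (σ * (q₀ f ^ (2 * j) * q₃ f ^ e)) (-(d * (q₀ f ^ (3 * j) * q₃ f ^ 0))),
    pow_ne_zero _ (neg_ne_zero.mpr h3), chi3_natDegree_le ?_ ?_ ?_, ?_⟩
  · rw [natDegree_neg]
    refine natDegree_mul_le.trans ?_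
    rw [natDegree_q₀_pow_mul_q₃_pow, add_zero]
    exact (natDegree_tr3_compM_pow_le h₁ h₂ h₃ e).trans (by omega)
  · refine natDegree_mul_le.trans ?_
    rw [natDegree_q₀_pow_mul_q₃_pow, add_zero]
    exact (natDegree_c23_compM_pow_le h₁ h₂ h₃ e).trans (by omega)
  · rw [natDegree_neg]
    refine natDegree_mul_le.trans ?_
    rw [natDegree_q₀_pow_mul_q₃_pow, add_zero]
    exact (natDegree_det3_compM_pow_le h₃ e).trans (by omega)
  · -- the transport identity: `relPoly = q₀^{3j}·ρ_e(q₃Y) + (W − Z)·(…)`, `W = q₃^e ψ`, `Z = q₀^j (q₃Y)^e`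
    have hC : (C (C ((-f.coeff 3) ^ (3 * e))) : ℤ[X][X]) = C (q₃ f) ^ (3 * e) := by
      rw [q₃, ← map_pow, ← map_pow]
    have hrel : relPoly 3 ((-f.coeff 3) ^ (3 * e)) (chi3 (-(t * (q₀ f ^ j * q₃ f ^ (2 * e))))
        (σ * (q₀ f ^ (2 * j) * q₃ f ^ e)) (-(d * (q₀ f ^ (3 * j) * q₃ f ^ 0)))) (N f ^ j * X ^ (j + e)) 1 =
        C (q₀ f) ^ (3 * j) * (powRel (-q₂ f) (q₃ f * q₁ f) (-(q₃ f ^ 2 * q₀ f)) e).comp (C (q₃ f) * X) +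
        ((N f * X) ^ j - C (q₀ f) ^ j) * (C (q₃ f) ^ e * X ^ e *
          ((C (q₃ f) ^ e * X ^ e) ^ 2 * ((N f * X) ^ j) ^ 2 +
            (C (q₃ f) ^ e * X ^ e) ^ 2 * (N f * X) ^ j * C (q₀ f) ^ j +
            (C (q₃ f) ^ e * X ^ e) ^ 2 * (C (q₀ f) ^ j) ^ 2 -
            C t * C (q₀ f) ^ j * (C (q₃ f) ^ e * X ^ e) * ((N f * X) ^ j + C (q₀ f) ^ j) +
            C σ * C (q₀ f) ^ (2 * j))) := by
      rw [relPoly_three, hC, powRel, ← hM, ← ht, ← hσ, ← hd, chi3_one, chi3_two, chi3_three]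
      simp only [sub_comp, add_comp, mul_comp, pow_comp, X_comp, C_comp, map_neg, map_mul, map_pow,
        pow_zero, mul_one, one_pow]
      ring
    unfold QDvd
    rw [hrel, ratModel_apply]
    refine map_dvd (mapRingHom (Int.castRingHom ℚ)) (dvd_add ?_ ?_)
    · exact dvd_mul_of_dvd_right (sqLinQ_dvd_powRelY f e) _
    · exact dvd_mul_of_dvd_left (sqLinQ_dvd_NX_pow_sub f j) _

/-- `{f : ℤ[X]} (h3 : f.coeff 3 ≠ 0) (h0 : f.coeff 0 ≠ 1) (j : ℕ) : ¬ QDvd (sqLinQ f) (N f ^ j)`. -/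
theorem not_qdvd_N_pow {f : ℤ[X]} (h3 : f.coeff 3 ≠ 0) (h0 : f.coeff 0 ≠ 1) (j : ℕ) :
    ¬ QDvd (sqLinQ f) (N f ^ j) := by
  intro h
  have hn : 1 ≤ (sqLinQ f).natDegree := by rw [natDegree_sqLinQ h3]; norm_num
  apply not_qdvd_C hn (pow_ne_zero j (q₀_ne_zero h0))
  have h1 : QDvd (sqLinQ f) ((N f * X) ^ j) := by
    unfold QDvd at h ⊢; rw [mul_pow, ratModel_mul]; exact dvd_mul_of_dvd_left h _
  have h2 : QDvd (sqLinQ f) ((N f * X) ^ j - C (q₀ f) ^ j) := by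
    unfold QDvd; rw [ratModel_apply, ratModel_apply]
    exact map_dvd (mapRingHom (Int.castRingHom ℚ)) (sqLinQ_dvd_NX_pow_sub f j)
  unfold QDvd at h1 h2 ⊢
  have := (dvd_sub h1 h2)
  rwa [ratModel_sub, sub_sub_cancel, ← map_pow] at this

/-- **CHART 2 OF `𝒞₃` — PROVED**: `SiegelFunctions (sqLinQ f)` for every `f` with `f₃ ≠ 0` and `f₀ ≠ 1`
(`c = 2`; for `b ≥ 1`: `j = (2b+2)/3`, `e = b − j`, `a = max j 2e`, `φ = N^j`, `ψ = N^j·Y^b`). -/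
theorem siegelFunctions_sqLinQ {f : ℤ[X]} (h3 : f.coeff 3 ≠ 0) (h0 : f.coeff 0 ≠ 1) :
    SiegelFunctions (sqLinQ f) := by
  have hn : (sqLinQ f).natDegree = 3 := natDegree_sqLinQ h3
  have hk : xdeg (sqLinQ f) = 2 := xdeg_sqLinQ f
  refine ⟨2, fun b hb => ?_⟩
  obtain ⟨j, hj⟩ : ∃ j, j = (2 * b + 2) / 3 := ⟨_, rfl⟩
  obtain ⟨e, he⟩ : ∃ e, e = b - j := ⟨_, rfl⟩
  have hbe : b = j + e := by omega
  refine ⟨max j (2 * e), N f ^ j, 1, ?_, not_qdvd_N_pow h3 h0 j, not_qdvd_one (by omega), ?_, ?_⟩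
  · rw [hn, hk]; omega
  · exact integralOfDegree_mono (le_max_left _ _) (integralOfDegree_N_pow f j)
  · rw [hbe]
    exact integralOfDegree_mono (le_max_right _ _) (integralOfDegree_N_pow_mul_X_pow h3 j e)

/-- `{f : ℤ[X]} (hf : f.natDegree = 3) : f.coeff 3 ≠ 0`. -/
theorem coeff_three_ne_zero {f : ℤ[X]} (hf : f.natDegree = 3) : f.coeff 3 ≠ 0 := by
  have hf0 : f ≠ 0 := by rintro rfl; simp at hf
  have := leadingCoeff_ne_zero.mpr hf0
  rwa [leadingCoeff, hf] at this

/-- **`SqLinSwapSiegel` — PROVED** (chart 2 of `𝒞₃`, hypothesis-free). -/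
theorem sqLinSwapSiegel : SqLinSwapSiegel := fun f hf h0 => by
  rw [swap_sqLinP_eq hf.le]; exact siegelFunctions_sqLinQ (coeff_three_ne_zero hf) h0

/-- **BOTH CHARTS DISCHARGED ON `𝒞₃`**: `ThinFibreAt 2 ((xY − 1)² − f(x))` for EVERY cubic `f` with `f(0) ≠ 1`
and the curve geometrically irreducible (`siegelFunctions_sqLinP`, `sqLinSwapSiegel`); the irreducibility hypothesis
is removed in §11–§12 (`thinFibreAt_two_sqLinP`).  ×0-as-record (RULING L3160: the family is lever-decided). -/
theorem thinFibreAt_two_sqLinP_of_geomIrreducible {f : ℤ[X]} (hf : f.natDegree = 3) (h0 : f.coeff 0 ≠ 1)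
    (hgi : GeomIrreducible (sqLinP f)) : ThinFibreAt 2 (sqLinP f) :=
  thinFibreAt_two_sqLinP_of sqLinSwapSiegel hf h0 hgi

/-- … and at every exponent `m₀ ≥ 2`. -/
theorem thinFibreAt_sqLinP_of_geomIrreducible {f : ℤ[X]} (hf : f.natDegree = 3) (h0 : f.coeff 0 ≠ 1)
    (hgi : GeomIrreducible (sqLinP f)) {m₀ : ℕ} (hm : 2 ≤ m₀) : ThinFibreAt m₀ (sqLinP f) :=
  thinFibreAt_sqLinP_of_swap (by omega) hgi (sqLinSwapSiegel f hf h0) hm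

/-- the height comparison itself on `𝒞₃`, hypothesis-free but for geometric irreducibility. -/
theorem heightComparisonAt_sqLinP_of_geomIrreducible {f : ℤ[X]} (hf : f.natDegree = 3) (h0 : f.coeff 0 ≠ 1)
    (hgi : GeomIrreducible (sqLinP f)) : HeightComparisonAt (sqLinP f) :=
  heightComparisonAt_of_siegelFunctions hgi (by rw [xdeg_sqLinP (by omega)]; omega)
    (by rw [natDegree_sqLinP]; omega) (siegelFunctions_sqLinP f (by omega)) (sqLinSwapSiegel f hf h0)

end Chart2

end Summit.Schanuel.Schanuel.Theorems.RootDecomp1KSiegelFunctions
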